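/-
Copyright (c) 2026 the pub-hodgecm-mathlib formalisation cell (harness21).  Prover seat hodgecm-mathlib-K2Liu-p14 (g2), Track B «K2-LIT»,
#184♮ = hLiu418 = `stmt-HodgeConjecture-24832`; #42F′ Road I, A7-val ROAD (σ) brick V3 (O2) FILE A (K2Liu-p09 (g6) memo 0ec4b1215f8a4fcc §3c; LEAD «M-158d»;
interface K2Liu-p09 11:27:21Z (q3)).
-/
import Mathlib.LinearAlgebra.FiniteDimensional.Lemmas
import Mathlib.LinearAlgebra.Projection
import Mathlib.Algebra.Module.Projective
import Mathlib.LinearAlgebra.Dimension.Free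
import HarnessLib

/-!
# Crux `HLiu418`, A7-val road (σ), brick V3 (O2) FILE A: COMPOSABLE PAIRS `U →α V →β W` WITH `β ∘ α = 0` ARE CLASSIFIED UP TO `GL(U) × GL(V) × GL(W)` BY
# THE TWO RANKS — the coordinate-free engine of the split null-cone orbit table

Cell `hodgecm-mathlib`, crux item hLiu418 = `stmt-HodgeConjecture-24832`; squad K2 ∕ K2Liu; prover K2Liu-p14 (g2).  THEOREMS ONLY (no `def`, no instance, no
notation, no named-fact hypothesis, no `sorry`); lane `--supports stmt-HodgeConjecture-24832 --as helper`.  GENERIC linear algebra over a field (Mathlib only).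

WHY.  At a split place `v` the auxiliary hermitian space gives `U(V′_v) ≅ GL₃(F_v)` and the Schrödinger space `X ≅ M_{3×2}(F_v) × M_{2×3}(F_v)` with moment map
`Q(A, B) = BA`; the null cone `{BA = 0}` is stratified by `(rk A, rk B)` and V5-split needs that EACH STRATUM IS ONE ORBIT of `GL₃ × GL₂ × GL₂`
(`A ↦ g A a₁⁻¹`, `B ↦ a₂ B g⁻¹`).  Coordinate-free: a pair `(α : U → V, β : V → W)` with `β ∘ α = 0` is the flag `range α ≤ ker β ≤ V` plus the two ranks, and
any two pairs with the same ranks are conjugate.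
* §1 **`exists_linearEquiv_map_eq_map_eq`** (FLAG): for flags `R ≤ K`, `R′ ≤ K′` in `V` with `dim R = dim R′`, `dim K = dim K′` there is `e ∈ GL(V)` with
  `e(R) = R′`, `e(K) = K′` (three graded pieces `R ⊕ K∕R ⊕ V∕K` via ★ `Submodule.prodEquivOfIsCompl`, ★ `LinearEquiv.ofFinrankEq`).
* §2 **`exists_linearEquiv_comp_eq_of_range_eq`** (L2): `range γ = range α′ ⇒ ∃ e ∈ GL(U), α′ ∘ e = γ` (a section of `α′` onto its range, a retraction onto
  `ker γ`, `ker γ ≃ ker α′`, ★ `LinearEquiv.ofInjectiveEndo`).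
* §3 **`exists_linearEquiv_comp_eq_of_ker_eq`** (L3): `ker δ = ker β₂ ⇒ ∃ e ∈ GL(W), e ∘ δ = β₂` (dually: a section of `δ`, complements of the ranges, ★
  `LinearMap.ofIsCompl`).
* §4 **`exists_linearEquiv_conj_of_finrank_range_eq`** (MAIN): `β ∘ α = 0 = β′ ∘ α′`, `rk α = rk α′`, `rk β = rk β′` ⇒
  `∃ eU eV eW, eV ∘ α = α′ ∘ eU ∧ eW ∘ β = β′ ∘ eV`.
The matrix∕strata form for `M_{3×2} × M_{2×3}` and the openness filtration are FILE B `K2LiuNullConeOrbitsSplit`.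
References: [KudlaRallis1990, §2 (orbit structure of the null cone)]; [Rallis1984]; [BernsteinZelevinsky1976, §1.5]; elementary linear algebra (rank normal forms).
HONEST LABEL.  Count-neutral helper: `HC_CM` is proved only modulo the 7 printed citations (2 remaining named inputs: hLiu418 = `stmt-HodgeConjecture-24832`,
h413 = `stmt-HodgeConjecture-24833`) until rung 0 closes.
-/

set_option autoImplicit false
set_option linter.dupNamespace false -- the mandated namespace repeats `HodgeConjecture.HodgeConjecture`

namespace Summit.HodgeConjecture.HodgeConjecture.Cruxes.HLiu418.K2LiuLinearPairOrbit

open Module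

variable {F : Type*} [Field F]

/-! ## §1 Flags `R ≤ K ≤ V` with prescribed dimensions are conjugate under `GL(V)` -/

section Flag

variable {V : Type*} [AddCommGroup V] [Module F V] [FiniteDimensional F V]

/-- the two summands of a complementary pair add up in dimension. [folklore] -/
theorem finrank_add_finrank_of_isCompl {M : Type*} [AddCommGroup M] [Module F M] [FiniteDimensional F M] {p q : Submodule F M} (h : IsCompl p q) :
    finrank F p + finrank F q = finrank F M := by
  rw [← Module.finrank_prod, (Submodule.prodEquivOfIsCompl p q h).finrank_eq]

/-- **FLAG TRANSITIVITY**: two flags `R ≤ K`, `R′ ≤ K′` of subspaces of `V` with `dim R = dim R′` and `dim K = dim K′` are conjugate under `GL(V)`: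
`∃ e, e(R) = R′ ∧ e(K) = K′`. [cite: BernsteinZelevinsky1976, §1.5] -/
theorem exists_linearEquiv_map_eq_map_eq {R K R' K' : Submodule F V} (hRK : R ≤ K) (hRK' : R' ≤ K')
    (hR : finrank F R = finrank F R') (hK : finrank F K = finrank F K') :
    ∃ e : V ≃ₗ[F] V, R.map (e : V →ₗ[F] V) = R' ∧ K.map (e : V →ₗ[F] V) = K' := by
  obtain ⟨Q, hQ⟩ := K.exists_isCompl
  obtain ⟨Q', hQ'⟩ := K'.exists_isCompl
  obtain ⟨P, hP⟩ := (R.comap K.subtype).exists_isCompl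
  obtain ⟨P', hP'⟩ := (R'.comap K'.subtype).exists_isCompl
  -- dimension bookkeeping
  have hRc : finrank F (R.comap K.subtype) = finrank F R := (Submodule.comapSubtypeEquivOfLe hRK).finrank_eq
  have hRc' : finrank F (R'.comap K'.subtype) = finrank F R' := (Submodule.comapSubtypeEquivOfLe hRK').finrank_eq
  have hKs := finrank_add_finrank_of_isCompl hP
  have hKs' := finrank_add_finrank_of_isCompl hP'
  have hVs := finrank_add_finrank_of_isCompl hQ
  have hVs' := finrank_add_finrank_of_isCompl hQ'
  have hPP' : finrank F P = finrank F P' := by omega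
  have hQQ' : finrank F Q = finrank F Q' := by omega
  -- graded isomorphisms and their sum
  let eR : R.comap K.subtype ≃ₗ[F] R'.comap K'.subtype :=
    (Submodule.comapSubtypeEquivOfLe hRK).trans ((LinearEquiv.ofFinrankEq R R' hR).trans (Submodule.comapSubtypeEquivOfLe hRK').symm)
  let eP : P ≃ₗ[F] P' := LinearEquiv.ofFinrankEq P P' hPP'
  let eQ : Q ≃ₗ[F] Q' := LinearEquiv.ofFinrankEq Q Q' hQQ'
  let eK : K ≃ₗ[F] K' := ((Submodule.prodEquivOfIsCompl _ _ hP).symm.trans (eR.prodCongr eP)).trans (Submodule.prodEquivOfIsCompl _ _ hP')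
  let e : V ≃ₗ[F] V := ((Submodule.prodEquivOfIsCompl _ _ hQ).symm.trans (eK.prodCongr eQ)).trans (Submodule.prodEquivOfIsCompl _ _ hQ')
  have heK : ∀ k : K, e k = (eK k : V) := fun k => by
    simp only [e, LinearEquiv.trans_apply, Submodule.prodEquivOfIsCompl_symm_apply_left, LinearEquiv.prodCongr_apply, map_zero,
      Submodule.coe_prodEquivOfIsCompl', Submodule.coe_zero, add_zero]
  have heR : ∀ r : R.comap K.subtype, eK r = (eR r : K') := fun r => by
    simp only [eK, LinearEquiv.trans_apply, Submodule.prodEquivOfIsCompl_symm_apply_left, LinearEquiv.prodCongr_apply, map_zero,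
      Submodule.coe_prodEquivOfIsCompl', Submodule.coe_zero, add_zero]
  refine ⟨e, ?_, ?_⟩
  · apply Submodule.eq_of_le_of_finrank_eq
    · rintro _ ⟨r, hr, rfl⟩
      have hrK : r ∈ K := hRK hr
      have hrc : (⟨r, hrK⟩ : K) ∈ R.comap K.subtype := hr
      have h1 : e r = ((eR ⟨⟨r, hrK⟩, hrc⟩ : K') : V) := (heK ⟨r, hrK⟩).trans (congrArg Subtype.val (heR ⟨⟨r, hrK⟩, hrc⟩))
      rw [LinearEquiv.coe_coe, h1]
      exact (eR ⟨⟨r, hrK⟩, hrc⟩).2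
    · rw [LinearEquiv.finrank_map_eq, hR]
  · apply Submodule.eq_of_le_of_finrank_eq
    · rintro _ ⟨k, hk, rfl⟩
      rw [LinearEquiv.coe_coe, (heK ⟨k, hk⟩ : e k = (eK ⟨k, hk⟩ : V))]
      exact (eK ⟨k, hk⟩).2
    · rw [LinearEquiv.finrank_map_eq, hK]

end Flag

/-! ## §2 Two maps with the same range differ by an automorphism of the source -/

section RangeEq

variable {U V : Type*} [AddCommGroup U] [Module F U] [AddCommGroup V] [Module F V] [FiniteDimensional F U]

omit [FiniteDimensional F U] in
/-- a right inverse of the range restriction is a section: `α (s y) = y`. [folklore] -/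
theorem apply_section_eq (α : U →ₗ[F] V) {s : LinearMap.range α →ₗ[F] U} (hs : α.rangeRestrict ∘ₗ s = LinearMap.id) (y : LinearMap.range α) :
    α (s y) = y :=
  congrArg Subtype.val (LinearMap.congr_fun hs y)

/-- **(L2) `range γ = range α ⇒ α ∘ e = γ` for some `e ∈ GL(U)`.** [cite: BernsteinZelevinsky1976, §1.5] -/
theorem exists_linearEquiv_comp_eq_of_range_eq (γ α : U →ₗ[F] V) (h : LinearMap.range γ = LinearMap.range α) :
    ∃ e : U ≃ₗ[F] U, α ∘ₗ (e : U →ₗ[F] U) = γ := by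
  obtain ⟨s, hs⟩ := α.rangeRestrict.exists_rightInverse_of_surjective (LinearMap.range_rangeRestrict α)
  obtain ⟨π, hπ⟩ := (LinearMap.ker γ).subtype.exists_leftInverse_of_injective (Submodule.ker_subtype _)
  have hker : finrank F (LinearMap.ker γ) = finrank F (LinearMap.ker α) := by
    have h1 := γ.finrank_range_add_finrank_ker
    have h2 := α.finrank_range_add_finrank_ker
    rw [h] at h1
    omega
  let κ : LinearMap.ker γ ≃ₗ[F] LinearMap.ker α := LinearEquiv.ofFinrankEq _ _ hker
  let γR : U →ₗ[F] LinearMap.range α := (LinearEquiv.ofEq _ _ h : LinearMap.range γ ≃ₗ[F] LinearMap.range α) ∘ₗ γ.rangeRestrict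
  have hγR : ∀ u, ((γR u : LinearMap.range α) : V) = γ u := fun u => rfl
  let e₀ : U →ₗ[F] U := s ∘ₗ γR + (LinearMap.ker α).subtype ∘ₗ (κ : LinearMap.ker γ →ₗ[F] LinearMap.ker α) ∘ₗ π
  have he₀ : ∀ u, α (e₀ u) = γ u := fun u => by
    simp only [e₀, LinearMap.add_apply, LinearMap.comp_apply, map_add, apply_section_eq α hs, hγR, LinearEquiv.coe_coe, Submodule.coe_subtype,
      LinearMap.map_coe_ker, add_zero]
  have hπ' : ∀ u (hu : u ∈ LinearMap.ker γ), π u = ⟨u, hu⟩ := fun u hu => LinearMap.congr_fun hπ ⟨u, hu⟩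
  have hinj : Function.Injective e₀ := by
    rw [← LinearMap.ker_eq_bot, LinearMap.ker_eq_bot']
    intro u hu
    have hγu : γ u = 0 := by rw [← he₀ u, hu, map_zero]
    have hγRu : γR u = 0 := Subtype.ext (by rw [hγR, hγu]; rfl)
    have hu' : u ∈ LinearMap.ker γ := hγu
    have : ((κ ⟨u, hu'⟩ : LinearMap.ker α) : U) = 0 := by
      have h := hu
      simp only [e₀, LinearMap.add_apply, LinearMap.comp_apply, hγRu, map_zero, zero_add, hπ' u hu', LinearEquiv.coe_coe, Submodule.coe_subtype] at h
      exact h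
    rw [Submodule.coe_eq_zero, map_eq_zero_iff _ κ.injective] at this
    exact congrArg Subtype.val this
  refine ⟨LinearEquiv.ofInjectiveEndo e₀ hinj, ?_⟩
  ext u
  exact he₀ u

end RangeEq

/-! ## §3 Two maps with the same kernel differ by an automorphism of the target -/

section KerEq

variable {V W : Type*} [AddCommGroup V] [Module F V] [AddCommGroup W] [Module F W] [FiniteDimensional F V] [FiniteDimensional F W]

omit [FiniteDimensional F W] in
/-- in a complementary pair a sum `x + y = 0` (`x ∈ p`, `y ∈ q`) forces `y = 0`. [folklore] -/
theorem eq_zero_of_add_eq_zero_of_isCompl {p q : Submodule F W} (h : IsCompl p q) {x y : W} (hx : x ∈ p) (hy : y ∈ q) (hxy : x + y = 0) : y = 0 := by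
  have hy' : y ∈ p := by
    rw [show y = -x from eq_neg_of_add_eq_zero_right hxy]
    exact p.neg_mem hx
  exact (Submodule.disjoint_def.1 h.disjoint) y hy' hy

/-- **(L3) `ker δ = ker β ⇒ e ∘ δ = β` for some `e ∈ GL(W)`.** [cite: BernsteinZelevinsky1976, §1.5] -/
theorem exists_linearEquiv_comp_eq_of_ker_eq (δ β : V →ₗ[F] W) (h : LinearMap.ker δ = LinearMap.ker β) :
    ∃ e : W ≃ₗ[F] W, (e : W →ₗ[F] W) ∘ₗ δ = β := by
  obtain ⟨σ, hσ⟩ := δ.rangeRestrict.exists_rightInverse_of_surjective (LinearMap.range_rangeRestrict δ)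
  obtain ⟨C, hC⟩ := (LinearMap.range δ).exists_isCompl
  obtain ⟨C', hC'⟩ := (LinearMap.range β).exists_isCompl
  have hCC' : finrank F C = finrank F C' := by
    have h1 := δ.finrank_range_add_finrank_ker
    have h2 := β.finrank_range_add_finrank_ker
    have h3 := finrank_add_finrank_of_isCompl hC
    have h4 := finrank_add_finrank_of_isCompl hC'
    rw [h] at h1
    omega
  let lam : C ≃ₗ[F] C' := LinearEquiv.ofFinrankEq _ _ hCC'
  let e₀ : W →ₗ[F] W := LinearMap.ofIsCompl hC (β ∘ₗ σ) (C'.subtype ∘ₗ (lam : C →ₗ[F] C'))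
  have hδσ : ∀ y : LinearMap.range δ, δ (σ y) = y := apply_section_eq δ hσ
  have hβσ : ∀ v, β (σ (δ.rangeRestrict v)) = β v := fun v => by
    have hk : σ (δ.rangeRestrict v) - v ∈ LinearMap.ker β := by
      rw [← h, LinearMap.mem_ker, map_sub, hδσ, sub_eq_zero]
      rfl
    rwa [LinearMap.mem_ker, map_sub, sub_eq_zero] at hk
  have he₀ : ∀ v, e₀ (δ v) = β v := fun v => by
    rw [show δ v = ((δ.rangeRestrict v : LinearMap.range δ) : W) from rfl]
    simp only [e₀, LinearMap.ofIsCompl_apply_left, LinearMap.comp_apply, hβσ]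
  have hinj : Function.Injective e₀ := by
    rw [← LinearMap.ker_eq_bot, LinearMap.ker_eq_bot']
    intro w hw
    obtain ⟨⟨x, y⟩, rfl⟩ := (Submodule.prodEquivOfIsCompl _ _ hC).surjective w
    rw [Submodule.coe_prodEquivOfIsCompl', map_add] at hw
    simp only [e₀, LinearMap.ofIsCompl_apply_left, LinearMap.ofIsCompl_apply_right, LinearMap.comp_apply, LinearEquiv.coe_coe, Submodule.coe_subtype] at hw
    -- `β (σ x) + lam y = 0` with summands in the complementary pair `range β`, `C′`
    have hy0 : ((lam y : C') : W) = 0 := eq_zero_of_add_eq_zero_of_isCompl hC' (LinearMap.mem_range_self β _) (lam y).2 hw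
    have hy : y = 0 := by
      rw [Submodule.coe_eq_zero, map_eq_zero_iff _ lam.injective] at hy0
      exact hy0
    rw [hy, map_zero, Submodule.coe_zero, add_zero] at hw
    have hx : x = 0 := by
      have hmem : σ x ∈ LinearMap.ker δ := by rw [h]; exact hw
      have : (x : W) = 0 := by rw [← hδσ x]; exact hmem
      exact Submodule.coe_eq_zero.1 this
    rw [hx, hy, Submodule.coe_prodEquivOfIsCompl', Submodule.coe_zero, Submodule.coe_zero, add_zero]
  refine ⟨LinearEquiv.ofInjectiveEndo e₀ hinj, ?_⟩
  ext v
  exact he₀ v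

end KerEq

/-! ## §4 Composable pairs with `β ∘ α = 0` are classified by the two ranks -/

section Main

variable {U V W : Type*} [AddCommGroup U] [Module F U] [AddCommGroup V] [Module F V] [AddCommGroup W] [Module F W]
  [FiniteDimensional F U] [FiniteDimensional F V] [FiniteDimensional F W]

/-- **COMPOSABLE PAIRS WITH ZERO COMPOSITE ARE CLASSIFIED BY THEIR RANKS.**  If `β ∘ α = 0 = β′ ∘ α′` (`α, α′ : U → V`, `β, β′ : V → W`) and
`rk α = rk α′`, `rk β = rk β′`, then `(α, β)` and `(α′, β′)` are conjugate under `GL(U) × GL(V) × GL(W)`: `eV ∘ α = α′ ∘ eU` and `eW ∘ β = β′ ∘ eV`.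
(FLAG on `range α ≤ ker β`, then (L2) for `eV ∘ α` vs `α′`, (L3) for `β` vs `β′ ∘ eV`.)  The engine of the split null-cone orbit table: each stratum
`{rk A = i, rk B = j, BA = 0}` of `M_{3×2} × M_{2×3}` is one `GL₃ × GL₂ × GL₂`-orbit. [cite: KudlaRallis1990, §2] [cite: BernsteinZelevinsky1976, §1.5] -/
theorem exists_linearEquiv_conj_of_finrank_range_eq (α α' : U →ₗ[F] V) (β β' : V →ₗ[F] W) (h : β ∘ₗ α = 0) (h' : β' ∘ₗ α' = 0)
    (hα : finrank F (LinearMap.range α) = finrank F (LinearMap.range α'))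
    (hβ : finrank F (LinearMap.range β) = finrank F (LinearMap.range β')) :
    ∃ (eU : U ≃ₗ[F] U) (eV : V ≃ₗ[F] V) (eW : W ≃ₗ[F] W),
      (eV : V →ₗ[F] V) ∘ₗ α = α' ∘ₗ (eU : U →ₗ[F] U) ∧ (eW : W →ₗ[F] W) ∘ₗ β = β' ∘ₗ (eV : V →ₗ[F] V) := by
  have hle : LinearMap.range α ≤ LinearMap.ker β := LinearMap.range_le_ker_iff.2 h
  have hle' : LinearMap.range α' ≤ LinearMap.ker β' := LinearMap.range_le_ker_iff.2 h'
  have hker : finrank F (LinearMap.ker β) = finrank F (LinearMap.ker β') := by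
    have h1 := β.finrank_range_add_finrank_ker
    have h2 := β'.finrank_range_add_finrank_ker
    omega
  obtain ⟨eV, hR, hK⟩ := exists_linearEquiv_map_eq_map_eq hle hle' hα hker
  have hrange : LinearMap.range ((eV : V →ₗ[F] V) ∘ₗ α) = LinearMap.range α' := by rw [LinearMap.range_comp, hR]
  obtain ⟨eU, heU⟩ := exists_linearEquiv_comp_eq_of_range_eq ((eV : V →ₗ[F] V) ∘ₗ α) α' hrange
  have hkerc : LinearMap.ker β = LinearMap.ker (β' ∘ₗ (eV : V →ₗ[F] V)) := by
    rw [LinearMap.ker_comp, ← hK, Submodule.comap_map_eq_of_injective eV.injective]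
  obtain ⟨eW, heW⟩ := exists_linearEquiv_comp_eq_of_ker_eq β (β' ∘ₗ (eV : V →ₗ[F] V)) hkerc
  exact ⟨eU, eV, eW, heU.symm, heW⟩

end Main

end Summit.HodgeConjecture.HodgeConjecture.Cruxes.HLiu418.K2LiuLinearPairOrbit
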